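import Literature.Analysis.Complex.ArgumentPrincipleRectangle
import Literature.NumberTheory.LFunctions.PerronKernel
import HarnessLib

/-!
# The Perron kernel against one nearby zero along a horizontal segment (Lagarias–Odlyzko)

Topic `Literature/NumberTheory/LFunctions` (namespace `Literature.NumberTheory.LFunctions`).
Everything in this file is PROVED; there are no named facts.

In the truncated explicit formula for `ψ` (or `ψ_K`, `ψ_C`) the horizontal sides of the contour at
height `±T` meet the local partial fraction `−ζ'/ζ(s) = −∑_{|γ − T| ≤ 1} 1/(s − ρ) + O(log T)`, and
each nearby zero `ρ = β + iγ` contributes `∫ x^s/(s(s − ρ)) dσ` along the segment. Choosing `T` at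
distance `≫ 1/log T` from all ordinates (Davenport §17; Montgomery–Vaughan Lemma 12.2) bounds this
by `log² T`, which is not uniform enough for number fields of large discriminant. Lagarias and
Odlyzko (*Effective versions of the Chebotarev density theorem* (1977), §7, estimate of `H*`;
made explicit as Lemma 5.2 of Winckler, *Théorème de Chebotarev effectif*, arXiv:1311.5715:
"Soit `ρ = β + iγ`, avec `0 < β < 1` et `γ ≠ t`. Si `|t| ≥ 2`, `x ≥ 2` et `1 < σ₁ ≤ 3`, alors
`|∫_{−1/4}^{σ₁} x^{σ+it}/((σ+it)(σ+it−ρ)) dσ| ≤ (σ₁ + 9/4) x^{σ₁}/((|t| − 1)(σ₁ − β))`") instead move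
the segment by Cauchy's theorem to the three other sides of a rectangle of height one lying on the
side of the segment away from `ρ`, where `|s − ρ|` is bounded below independently of `|γ − t|`.

* `norm_integral_zeroSegment_le` — the version needed under GRH by the tree's von Koch-type contour
  (left edge `σ = 1/4`, `Re ρ = 1/2`): for `x ≥ 1`, `1 < c ≤ 2`, `|t| ≥ 2`, `Re ρ = 1/2`, `Im ρ ≠ t`,
  `‖∫_{1/4}^{c} x^{σ+it}/((σ+it)(σ+it−ρ)) dσ‖ ≤ 8 x^c/(|t| − 1)`
  (bottom/top side: `|s − ρ| ≥ 1`, length `≤ 2`; side `σ = c`: `|s − ρ| ≥ 1/2`; side `σ = 1/4`: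
  `|s − ρ| ≥ 1/4`; everywhere `|s| ≥ |t| − 1`, `|x^s| ≤ x^c`).

## References

* J. C. Lagarias, A. M. Odlyzko, *Effective versions of the Chebotarev density theorem*, in:
  Algebraic Number Fields (Durham 1975), Academic Press 1977, 409–464, §7. [cite: LagariasOdlyzko1977, §7]
* B. Winckler, *Théorème de Chebotarev effectif*, arXiv:1311.5715 (2013), Lemme 5.2. [cite: Winckler2013, Lemme 5.2]
-/

noncomputable section

open Complex Set MeasureTheory Filter Topology intervalIntegral Real
open scoped Interval

namespace Literature.NumberTheory.LFunctions

/-- Pointwise bound for the kernel `x^s/(s(s − ρ))`: if `x ≥ 1`, `Re s ≤ c`, `‖s‖ ≥ m > 0` and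
`‖s − ρ‖ ≥ d > 0`, then `‖x^s/(s(s−ρ))‖ ≤ x^c/(m d)`. [folklore] -/
theorem norm_zeroSegmentKernel_le {x c m d : ℝ} {s ρ : ℂ} (hx : 1 ≤ x) (hsre : s.re ≤ c)
    (hm : 0 < m) (hd : 0 < d) (hsm : m ≤ ‖s‖) (hsd : d ≤ ‖s - ρ‖) :
    ‖(x : ℂ) ^ s / (s * (s - ρ))‖ ≤ x ^ c / (m * d) := by
  have hx0 : 0 < x := by linarith
  rw [norm_div, norm_mul, Complex.norm_cpow_eq_rpow_re_of_pos hx0]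
  have h1 : x ^ s.re ≤ x ^ c := Real.rpow_le_rpow_of_exponent_le hx hsre
  have h2 : m * d ≤ ‖s‖ * ‖s - ρ‖ := mul_le_mul hsm hsd hd.le (norm_nonneg _)
  exact div_le_div₀ (by positivity) h1 (by positivity) h2

/-- `‖σ + iy‖ ≥ |t| − 1` whenever `|y − t| ≤ 1`. [folklore] -/
theorem abs_sub_one_le_norm_of_abs_sub_le {σ y t : ℝ} (hy : |y - t| ≤ 1) :
    |t| - 1 ≤ ‖(σ : ℂ) + y * I‖ := by
  have him : ((σ : ℂ) + y * I).im = y := by simp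
  have h1 : |((σ : ℂ) + y * I).im| ≤ ‖(σ : ℂ) + y * I‖ := abs_im_le_norm _
  rw [him] at h1
  have h2 : |t| - 1 ≤ |y| := by
    have := abs_sub_abs_le_abs_sub t y
    rw [abs_sub_comm] at hy
    linarith
  linarith

/-- **One nearby zero along a horizontal segment** (Lagarias–Odlyzko 1977, §7; Winckler 2013,
Lemme 5.2, in the form needed under GRH with the left edge at `σ = 1/4`): for `x ≥ 1`,
`1 < c ≤ 2`, `|t| ≥ 2` and `ρ` with `Re ρ = 1/2`, `Im ρ ≠ t`,
`‖∫_{1/4}^{c} x^{σ+it}/((σ+it)(σ+it−ρ)) dσ‖ ≤ 8 x^c/(|t| − 1)`, uniformly in `|Im ρ − t|`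
(Cauchy's theorem on the rectangle `[1/4, c] × [t − 1, t]` if `Im ρ > t`, `[1/4, c] × [t, t + 1]`
if `Im ρ < t`). [cite: Winckler2013, Lemme 5.2] -/
theorem norm_integral_zeroSegment_le {x c t : ℝ} {ρ : ℂ} (hx : 1 ≤ x) (hc1 : 1 < c) (hc2 : c ≤ 2)
    (ht : 2 ≤ |t|) (hρ : ρ.re = 1 / 2) (hγ : ρ.im ≠ t) :
    ‖∫ σ in (1 / 4 : ℝ)..c,
        (x : ℂ) ^ ((σ : ℂ) + t * I) / (((σ : ℂ) + t * I) * ((σ : ℂ) + t * I - ρ))‖ ≤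
      8 * x ^ c / (|t| - 1) := by
  have hx0 : 0 < x := by linarith
  have ht1 : 1 ≤ |t| - 1 := by linarith
  have ht10 : 0 < |t| - 1 := by linarith
  have h14c : (1 / 4 : ℝ) ≤ c := by linarith
  have hxc0 : 0 ≤ x ^ c := by positivity
  set g : ℂ → ℂ := fun s ↦ (x : ℂ) ^ s / (s * (s - ρ)) with hg
  -- differentiability of `g` off `{0, ρ}`
  have hgd : ∀ s : ℂ, s ≠ 0 → s ≠ ρ → DifferentiableAt ℂ g s := fun s h0 hρ' ↦
    (differentiableAt_id.const_cpow (Or.inl (ofReal_ne_zero.2 hx0.ne'))).div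
      (differentiableAt_id.mul (differentiableAt_id.sub_const ρ))
      (mul_ne_zero h0 (sub_ne_zero.2 hρ'))
  -- points at height `y` with `|y - t| ≤ 1` are `≠ 0` (as `|t| ≥ 2`)
  have hne0 : ∀ (σ y : ℝ), |y - t| ≤ 1 → ((σ : ℂ) + y * I) ≠ 0 := by
    intro σ y hy h0
    have := abs_sub_one_le_norm_of_abs_sub_le (σ := σ) hy
    rw [h0, norm_zero] at this
    linarith
  -- the three generic side bounds
  -- (a) a horizontal side at height `y` with `|y - t| ≤ 1` and `|y - Im ρ| ≥ 1`
  have hH : ∀ y : ℝ, |y - t| ≤ 1 → 1 ≤ |y - ρ.im| →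
      ‖∫ σ in (1 / 4 : ℝ)..c, g ((σ : ℂ) + y * I)‖ ≤ 2 * (x ^ c / (|t| - 1)) := by
    intro y hy hyρ
    have hb : ∀ σ ∈ Ι (1 / 4 : ℝ) c, ‖g ((σ : ℂ) + y * I)‖ ≤ x ^ c / ((|t| - 1) * 1) := by
      intro σ hσ
      rw [uIoc_of_le h14c] at hσ
      refine norm_zeroSegmentKernel_le hx (by simp; exact hσ.2) ht10 one_pos
        (abs_sub_one_le_norm_of_abs_sub_le hy) ?_
      have : ((σ : ℂ) + y * I - ρ).im = y - ρ.im := by simp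
      calc (1 : ℝ) ≤ |y - ρ.im| := hyρ
        _ = |((σ : ℂ) + y * I - ρ).im| := by rw [this]
        _ ≤ ‖(σ : ℂ) + y * I - ρ‖ := abs_im_le_norm _
    refine (norm_integral_le_of_norm_le_const hb).trans ?_
    rw [mul_one, abs_of_nonneg (show (0 : ℝ) ≤ c - 1 / 4 by linarith)]
    have : c - 1 / 4 ≤ 2 := by linarith
    calc x ^ c / (|t| - 1) * (c - 1 / 4) ≤ x ^ c / (|t| - 1) * 2 :=
          mul_le_mul_of_nonneg_left this (by positivity)
      _ = 2 * (x ^ c / (|t| - 1)) := by ring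
  -- (b) the vertical side `σ = c` between heights `lo ≤ hi` with `|y - t| ≤ 1` there
  have hV : ∀ (a d : ℝ) (lo hi : ℝ), lo ≤ hi → hi - lo = 1 → a ≤ c → 0 < d →
      (∀ y ∈ Icc lo hi, |y - t| ≤ 1) → d ≤ |a - ρ.re| →
      ‖∫ y in lo..hi, g ((a : ℂ) + y * I)‖ ≤ x ^ c / ((|t| - 1) * d) := by
    intro a d lo hi hlohi hlen hac hd hyt hda
    have hb : ∀ y ∈ Ι lo hi, ‖g ((a : ℂ) + y * I)‖ ≤ x ^ c / ((|t| - 1) * d) := by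
      intro y hy
      rw [uIoc_of_le hlohi] at hy
      refine norm_zeroSegmentKernel_le hx (by simp; exact hac) ht10 hd
        (abs_sub_one_le_norm_of_abs_sub_le (hyt y (Ioc_subset_Icc_self hy))) ?_
      have : ((a : ℂ) + y * I - ρ).re = a - ρ.re := by simp
      calc d ≤ |a - ρ.re| := hda
        _ = |((a : ℂ) + y * I - ρ).re| := by rw [this]
        _ ≤ ‖(a : ℂ) + y * I - ρ‖ := abs_re_le_norm _
    refine (norm_integral_le_of_norm_le_const hb).trans ?_
    rw [hlen, abs_one, mul_one]
  -- distances from the two vertical sides to `ρ`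
  have hdc : (1 / 2 : ℝ) ≤ |c - ρ.re| := by rw [hρ, abs_of_nonneg (by linarith)]; linarith
  have hd14 : (1 / 4 : ℝ) ≤ |1 / 4 - ρ.re| := by rw [hρ]; norm_num
  -- the two cases
  rcases lt_or_gt_of_ne hγ with hlt | hgt
  · -- `Im ρ < t`: rectangle `[1/4, c] × [t, t + 1]`; our segment is its bottom side
    have hyt : ∀ y ∈ Icc t (t + 1), |y - t| ≤ 1 := fun y hy ↦ by
      rw [abs_le]; constructor <;> linarith [hy.1, hy.2]
    have hdiff : DifferentiableOn ℂ g (Icc (1 / 4 : ℝ) c ×ℂ Icc t (t + 1)) := by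
      intro s hs
      have hs' := mem_reProdIm.1 hs
      refine (hgd s ?_ ?_).differentiableWithinAt
      · intro h0
        have h1 := hs'.1.1
        rw [h0, Complex.zero_re] at h1
        norm_num at h1
      · intro hsρ; rw [hsρ] at hs'; linarith [hs'.2.1]
    have hCG := Literature.Analysis.Complex.rectBoundaryIntegral_eq_zero_of_differentiableOn
      h14c (by linarith : t ≤ t + 1) hdiff
    rw [Literature.Analysis.Complex.rectBoundaryIntegral_def] at hCG
    -- bottom = top - I right + I left
    have heq : (∫ σ in (1 / 4 : ℝ)..c, g ((σ : ℂ) + t * I)) =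
        (∫ σ in (1 / 4 : ℝ)..c, g ((σ : ℂ) + (t + 1 : ℝ) * I)) -
          I * (∫ y in t..(t + 1), g ((c : ℂ) + y * I)) +
          I * (∫ y in t..(t + 1), g (((1 / 4 : ℝ) : ℂ) + y * I)) := by
      linear_combination hCG
    have h1 := hH (t + 1) (by simp) (by rw [abs_of_pos (by linarith)]; linarith)
    have h2 := hV c (1 / 2) t (t + 1) (by linarith) (by ring) le_rfl (by norm_num) hyt hdc
    have h3 := hV (1 / 4) (1 / 4) t (t + 1) (by linarith) (by ring) h14c (by norm_num) hyt hd14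
    have e2 : ‖I * ∫ y in t..(t + 1), g ((c : ℂ) + y * I)‖ = ‖∫ y in t..(t + 1), g ((c : ℂ) + y * I)‖ := by
      rw [norm_mul, Complex.norm_I, one_mul]
    have e3 : ‖I * ∫ y in t..(t + 1), g (((1 / 4 : ℝ) : ℂ) + y * I)‖ =
        ‖∫ y in t..(t + 1), g (((1 / 4 : ℝ) : ℂ) + y * I)‖ := by
      rw [norm_mul, Complex.norm_I, one_mul]
    show ‖∫ σ in (1 / 4 : ℝ)..c, g ((σ : ℂ) + t * I)‖ ≤ 8 * x ^ c / (|t| - 1)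
    rw [heq]
    calc ‖(∫ σ in (1 / 4 : ℝ)..c, g ((σ : ℂ) + (t + 1 : ℝ) * I)) -
            I * (∫ y in t..(t + 1), g ((c : ℂ) + y * I)) +
            I * (∫ y in t..(t + 1), g (((1 / 4 : ℝ) : ℂ) + y * I))‖
        ≤ ‖(∫ σ in (1 / 4 : ℝ)..c, g ((σ : ℂ) + (t + 1 : ℝ) * I)) -
            I * (∫ y in t..(t + 1), g ((c : ℂ) + y * I))‖ +
            ‖I * (∫ y in t..(t + 1), g (((1 / 4 : ℝ) : ℂ) + y * I))‖ := norm_add_le _ _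
      _ ≤ ‖∫ σ in (1 / 4 : ℝ)..c, g ((σ : ℂ) + (t + 1 : ℝ) * I)‖ +
            ‖I * (∫ y in t..(t + 1), g ((c : ℂ) + y * I))‖ +
            ‖I * (∫ y in t..(t + 1), g (((1 / 4 : ℝ) : ℂ) + y * I))‖ := by
          gcongr; exact norm_sub_le _ _
      _ ≤ 2 * (x ^ c / (|t| - 1)) + x ^ c / ((|t| - 1) * (1 / 2)) + x ^ c / ((|t| - 1) * (1 / 4)) := by
          rw [e2, e3]; exact add_le_add (add_le_add h1 h2) h3
      _ = 8 * x ^ c / (|t| - 1) := by field_simp; ring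
  · -- `Im ρ > t`: rectangle `[1/4, c] × [t - 1, t]`; our segment is its top side
    have hyt : ∀ y ∈ Icc (t - 1) t, |y - t| ≤ 1 := fun y hy ↦ by
      rw [abs_le]; constructor <;> linarith [hy.1, hy.2]
    have hdiff : DifferentiableOn ℂ g (Icc (1 / 4 : ℝ) c ×ℂ Icc (t - 1) t) := by
      intro s hs
      have hs' := mem_reProdIm.1 hs
      refine (hgd s ?_ ?_).differentiableWithinAt
      · intro h0
        have h1 := hs'.1.1
        rw [h0, Complex.zero_re] at h1
        norm_num at h1
      · intro hsρ; rw [hsρ] at hs'; linarith [hs'.2.2]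
    have hCG := Literature.Analysis.Complex.rectBoundaryIntegral_eq_zero_of_differentiableOn
      h14c (by linarith : t - 1 ≤ t) hdiff
    rw [Literature.Analysis.Complex.rectBoundaryIntegral_def] at hCG
    -- top = bottom + I right - I left
    have heq : (∫ σ in (1 / 4 : ℝ)..c, g ((σ : ℂ) + t * I)) =
        (∫ σ in (1 / 4 : ℝ)..c, g ((σ : ℂ) + (t - 1 : ℝ) * I)) +
          I * (∫ y in (t - 1)..t, g ((c : ℂ) + y * I)) -
          I * (∫ y in (t - 1)..t, g (((1 / 4 : ℝ) : ℂ) + y * I)) := by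
      linear_combination -hCG
    have h1 := hH (t - 1) (by simp) (by
      rw [abs_of_neg (by linarith)]; linarith)
    have h2 := hV c (1 / 2) (t - 1) t (by linarith) (by ring) le_rfl (by norm_num) hyt hdc
    have h3 := hV (1 / 4) (1 / 4) (t - 1) t (by linarith) (by ring) h14c (by norm_num) hyt hd14
    have e2 : ‖I * ∫ y in (t - 1)..t, g ((c : ℂ) + y * I)‖ = ‖∫ y in (t - 1)..t, g ((c : ℂ) + y * I)‖ := by
      rw [norm_mul, Complex.norm_I, one_mul]
    have e3 : ‖I * ∫ y in (t - 1)..t, g (((1 / 4 : ℝ) : ℂ) + y * I)‖ =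
        ‖∫ y in (t - 1)..t, g (((1 / 4 : ℝ) : ℂ) + y * I)‖ := by
      rw [norm_mul, Complex.norm_I, one_mul]
    show ‖∫ σ in (1 / 4 : ℝ)..c, g ((σ : ℂ) + t * I)‖ ≤ 8 * x ^ c / (|t| - 1)
    rw [heq]
    calc ‖(∫ σ in (1 / 4 : ℝ)..c, g ((σ : ℂ) + (t - 1 : ℝ) * I)) +
            I * (∫ y in (t - 1)..t, g ((c : ℂ) + y * I)) -
            I * (∫ y in (t - 1)..t, g (((1 / 4 : ℝ) : ℂ) + y * I))‖
        ≤ ‖(∫ σ in (1 / 4 : ℝ)..c, g ((σ : ℂ) + (t - 1 : ℝ) * I)) +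
            I * (∫ y in (t - 1)..t, g ((c : ℂ) + y * I))‖ +
            ‖I * (∫ y in (t - 1)..t, g (((1 / 4 : ℝ) : ℂ) + y * I))‖ := norm_sub_le _ _
      _ ≤ ‖∫ σ in (1 / 4 : ℝ)..c, g ((σ : ℂ) + (t - 1 : ℝ) * I)‖ +
            ‖I * (∫ y in (t - 1)..t, g ((c : ℂ) + y * I))‖ +
            ‖I * (∫ y in (t - 1)..t, g (((1 / 4 : ℝ) : ℂ) + y * I))‖ := by
          gcongr; exact norm_add_le _ _
      _ ≤ 2 * (x ^ c / (|t| - 1)) + x ^ c / ((|t| - 1) * (1 / 2)) + x ^ c / ((|t| - 1) * (1 / 4)) := by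
          rw [e2, e3]; exact add_le_add (add_le_add h1 h2) h3
      _ = 8 * x ^ c / (|t| - 1) := by field_simp; ring

end Literature.NumberTheory.LFunctions

end
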